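import Literature.Probability.LatticeModels.BallPathGeometry
import HarnessLib

/-!
# Two ball paths share few edges: overlap `≤ 2(d+2) ·` number of near-meetings

Continuation of `BallPathGeometry` (Garban–Spencer, arXiv:2109.01617, Step 2 of the proof of
Theorem 1.3; Benjamini–Pemantle–Peres 1998, end of the proof of Theorem 1.3: "the number of edges
in common is at most the collision number").  For two paths `verts ω`, `verts ω'` of the same
frame we bound the number of common (unordered) lattice edges by `2(d+2)` times the number of
near-meeting times `τ ∈ [0, T]` of the pair `(ω, ω')` (`card_commonEdges_le`):

* the edges of a path are the edges of its blocks (`edges_verts`), each block has at most `d + 2`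
  edges (`length_blockTrail_le`);
* an edge determines its block through the *levels* (time coordinates) of its endpoints
  (`eq_of_mem_blockEdges`), so a common edge lies in the same block `t` of both paths, and then
  the two skeletons are within `4` of each other on the random axes, i.e. the pair near-meets at
  the clock time `τ_t` (`mem_M_of_mem_blockEdges`);
* the clock `t ↦ τ_t = min(t, T−t)` is at most two-to-one.

## References

* C. Garban, T. Spencer, arXiv:2109.01617, proof of Theorem 1.3, Step 2 and proof of Lemma 2.5
  (`|p₁ ∩ p₂|`). [GarbanSpencer2022]
* I. Benjamini, R. Pemantle, Y. Peres, arXiv:math/9701227, end of the proof of Theorem 1.3.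
  [BenjaminiPemantlePeres1998]
-/

noncomputable section

open Finset
open scoped BigOperators

namespace Literature.Probability.LatticeModels

namespace BallPath

open Trail DyadicWalk

variable {d : ℕ}

namespace Frame

variable (F : Frame d)

/-! ### Edges of blocks -/

/-- The edges of block `t`: those of `P(t) :: blockTrail t` (including the time step). [folklore] -/
def blockEdges (ω : F.Rnd) (t : ℕ) : List (Sym2 (Site d)) := edges (F.P ω t :: F.blockTrail ω t)

/-- Edges of a concatenation at the last vertex of the first part. [folklore] -/
theorem edges_append_of_ne_nil {α : Type*} (A L : List α) (hA : A ≠ []) :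
    edges (A ++ L) = edges A ++ edges (A.getLast hA :: L) := by
  conv_lhs => rw [← List.dropLast_append_getLast hA, List.append_assoc, List.singleton_append]
  rw [edges_append_cons, List.dropLast_append_getLast hA]

/-- **The edges of the path are the edges of its blocks.** [folklore] -/
theorem edges_verts_prefix (ω : F.Rnd) (n : ℕ) :
    edges (F.x :: trail F.x (F.allPh ω n)) = (List.range n).flatMap (F.blockEdges ω) := by
  induction n with
  | zero => simp [allPh]
  | succ n ih =>
    rw [trail_allPh_succ, ← List.cons_append, edges_append_of_ne_nil _ _ (List.cons_ne_nil _ _), ih,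
      getLast_cons_trail, x_add_disp_allPh, List.range_succ, List.flatMap_append, List.flatMap_singleton]
    rfl

/-- The edges of the whole path. [folklore] -/
theorem edges_verts (ω : F.Rnd) : edges (F.verts ω) = (List.range F.T).flatMap (F.blockEdges ω) :=
  F.edges_verts_prefix ω F.T

/-- The first vertex of a block trail is the time step `P(t) + σ e_{i₀}`. [folklore] -/
theorem blockTrail_eq (ω : F.Rnd) (t : ℕ) :
    F.blockTrail ω t = (F.P ω t + Pi.single F.i₀ F.σ) ::
      trail (F.P ω t + Pi.single F.i₀ F.σ) (F.others.map fun l => (l, F.Δ ω l t)) := by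
  have hn : F.σ.natAbs = 1 := by rcases F.σ_eq_or with h | h <;> simp [h]
  have hs : F.σ.sign = F.σ := by rcases F.σ_eq_or with h | h <;> simp [h]
  rw [blockTrail, blockPh, trail_cons, seg, hn, hs, segN_succ, segN_zero]
  rfl

/-- A block has at most `d + 2` edges (`1` time step, `≤ 2` steps on each random axis, `≤ 1` on
the others). [folklore] -/
theorem length_blockEdges_le (ω : F.Rnd) (t : ℕ) : (F.blockEdges ω t).length ≤ d + 2 := by
  classical
  rw [blockEdges, length_edges, List.length_cons, Nat.add_sub_cancel, blockTrail, length_trail, blockPh,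
    List.map_cons, List.sum_cons, List.map_map]
  have hn : F.σ.natAbs = 1 := by rcases F.σ_eq_or with h | h <;> simp [h]
  rw [hn]
  -- the transverse steps
  have hsum : ((F.others.map ((fun p : Fin d × ℤ => p.2.natAbs) ∘ fun l => (l, F.Δ ω l t))).sum) ≤ d + 1 := by
    have e : (F.others.map ((fun p : Fin d × ℤ => p.2.natAbs) ∘ fun l => (l, F.Δ ω l t))) =
        F.others.map (fun l => (F.Δ ω l t).natAbs) := List.map_congr_left fun l _ => rfl
    rw [e, ← List.sum_toFinset _ F.nodup_others]
    have hsub : F.others.toFinset = Finset.univ.erase F.i₀ := by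
      ext l; simp [others]
    rw [hsub]
    calc ∑ l ∈ Finset.univ.erase F.i₀, (F.Δ ω l t).natAbs
        ≤ ∑ l ∈ Finset.univ.erase F.i₀, (1 + (if l = F.j₀ then 1 else 0) + (if l = F.k₀ then 1 else 0)) := by
          refine Finset.sum_le_sum fun l _ => ?_
          by_cases hj : l = F.j₀
          · have := F.abs_Δ_le_two ω l t
            rw [if_pos hj]
            zify
            have h2 : ((F.Δ ω l t).natAbs : ℤ) ≤ 2 := by rw [Int.natCast_natAbs]; exact this
            have h3 : (0 : ℤ) ≤ ((if l = F.k₀ then 1 else 0 : ℕ) : ℤ) := by positivity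
            push_cast at h3 ⊢
            linarith
          · by_cases hk : l = F.k₀
            · have := F.abs_Δ_le_two ω l t
              rw [if_neg hj, if_pos hk]; zify
              have h2 : ((F.Δ ω l t).natAbs : ℤ) ≤ 2 := by rw [Int.natCast_natAbs]; exact this
              linarith
            · have := F.abs_Δ_le_one ω hj hk t
              rw [if_neg hj, if_neg hk]; zify
              have h2 : ((F.Δ ω l t).natAbs : ℤ) ≤ 1 := by rw [Int.natCast_natAbs]; exact this
              linarith
      _ = (d - 1) + 1 + 1 := by
          rw [Finset.sum_add_distrib, Finset.sum_add_distrib, Finset.sum_const, smul_eq_mul, mul_one,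
            Finset.card_erase_of_mem (Finset.mem_univ _), Finset.card_univ, Fintype.card_fin,
            Finset.sum_ite_eq' , Finset.sum_ite_eq']
          simp [F.hj, F.hk]
      _ ≤ d + 1 := by have := F.i₀.pos; omega
  omega

/-! ### Levels: an edge determines its block -/

/-- The level `L(t) = x_{i₀} + σ t`. [folklore] -/
def L (t : ℕ) : ℤ := F.x F.i₀ + F.σ * t

/-- `L` is injective. [folklore] -/
theorem L_injective : Function.Injective F.L := by
  intro t t' h
  unfold L at h
  have := mul_left_cancel₀ F.σ_ne_zero (by linarith : F.σ * t = F.σ * t')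
  exact_mod_cast this

/-- **Levels of block edges**: the endpoints of an edge of block `t` have levels `{L t, L(t+1)}`
(the time step) or `{L(t+1), L(t+1)}`. [folklore] -/
theorem map_level_of_mem_blockEdges (ω : F.Rnd) {t : ℕ} {e : Sym2 (Site d)} (he : e ∈ F.blockEdges ω t) :
    Sym2.map (fun w : Site d => w F.i₀) e = s(F.L t, F.L (t + 1)) ∨
      Sym2.map (fun w : Site d => w F.i₀) e = s(F.L (t + 1), F.L (t + 1)) := by
  have hP : F.P ω t F.i₀ = F.L t := F.cpos_i₀ ω t
  rcases mem_edges_cons he with ⟨b, hb, rfl⟩ | he'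
  · left
    rw [blockTrail_eq] at hb
    simp only [List.head?_cons, Option.some.injEq] at hb
    subst hb
    simp only [Sym2.map_mk, Pi.add_apply, Pi.single_eq_same, hP, L]
    push_cast; ring_nf
  · right
    induction e using Sym2.ind with
    | _ u w =>
      have hu := F.apply_i₀_of_mem_blockTrail ω (mem_of_mem_edges he' (Sym2.mem_mk_left u w))
      have hw := F.apply_i₀_of_mem_blockTrail ω (mem_of_mem_edges he' (Sym2.mem_mk_right u w))
      simp only [Sym2.map_mk, hu, hw, L]; push_cast; ring_nf

/-- **A common edge lies in the same block of both paths.** [folklore] -/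
theorem eq_of_mem_blockEdges (ω ω' : F.Rnd) {t t' : ℕ} {e : Sym2 (Site d)}
    (he : e ∈ F.blockEdges ω t) (he' : e ∈ F.blockEdges ω' t') : t = t' := by
  have hL := F.L_injective
  have key : ∀ a b : ℕ, F.L a = F.L b → a = b := fun a b h => hL h
  rcases F.map_level_of_mem_blockEdges ω he with h1 | h1 <;>
    rcases F.map_level_of_mem_blockEdges ω' he' with h2 | h2 <;>
    rw [h1, Sym2.eq_iff] at h2
  · rcases h2 with ⟨h, -⟩ | ⟨h, h'⟩
    · exact key _ _ h
    · have := key _ _ h; have := key _ _ h'; omega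
  · rcases h2 with ⟨h, h'⟩ | ⟨h, h'⟩ <;> (have := key _ _ h; have := key _ _ h'; omega)
  · rcases h2 with ⟨h, h'⟩ | ⟨h, h'⟩ <;> (have := key _ _ h; have := key _ _ h'; omega)
  · rcases h2 with ⟨h, -⟩ | ⟨h, -⟩ <;> (have := key _ _ h; omega)

/-! ### A common edge forces a near-meeting -/

/-- Every vertex of block `t` is within `2` of the skeleton point `P(t)` in every coordinate.
[folklore] -/
theorem abs_sub_cpos_le_of_mem_block (ω : F.Rnd) {t : ℕ} {z : Site d} (hz : z ∈ F.P ω t :: F.blockTrail ω t)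
    (l : Fin d) : |z l - F.cpos ω l t| ≤ 2 := by
  rw [List.mem_cons] at hz
  rcases hz with rfl | hz
  · simp [P]
  · have hu := F.apply_mem_uIcc_of_mem_blockTrail ω hz l
    have hΔ := F.abs_Δ_le_two ω l t
    rw [Δ, abs_le] at hΔ
    rw [abs_le]
    rcases Set.mem_uIcc.1 hu with ⟨h1, h2⟩ | ⟨h1, h2⟩ <;> constructor <;> linarith

/-- On a random axis the two skeletons differ exactly by the difference of the walks. [folklore] -/
theorem cpos_sub_cpos_random (ω ω' : F.Rnd) (a : Fin 2) (t : ℕ) :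
    F.cpos ω (if a = 0 then F.j₀ else F.k₀) t - F.cpos ω' (if a = 0 then F.j₀ else F.k₀) t =
      S ω a (F.tau t) - S ω' a (F.tau t) := by
  unfold cpos rand
  fin_cases a
  · simp [F.hjk]
  · simp [F.hjk.symm]

/-- **A common edge in block `t` forces a near-meeting at clock time `τ_t`.** [folklore] -/
theorem mem_M_of_mem_blockEdges (ω ω' : F.Rnd) {t : ℕ} {e : Sym2 (Site d)}
    (he : e ∈ F.blockEdges ω t) (he' : e ∈ F.blockEdges ω' t) :
    ((ω, ω') : Pair F.T F.T) ∈ M F.T F.T (F.tau t) := by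
  rw [M, if_pos (F.tau_le t)]
  intro a
  -- pick an endpoint of `e`
  induction e using Sym2.ind with
  | _ u w =>
    have hu : u ∈ F.P ω t :: F.blockTrail ω t := mem_of_mem_edges he (Sym2.mem_mk_left u w)
    have hu' : u ∈ F.P ω' t :: F.blockTrail ω' t := mem_of_mem_edges he' (Sym2.mem_mk_left u w)
    set l : Fin d := if a = 0 then F.j₀ else F.k₀
    have h1 := F.abs_sub_cpos_le_of_mem_block ω hu l
    have h2 := F.abs_sub_cpos_le_of_mem_block ω' hu' l
    have e := F.cpos_sub_cpos_random ω ω' a t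
    show |S ω a (F.tau t) - S ω' a (F.tau t)| ≤ 4
    rw [← e]
    rw [abs_le] at h1 h2 ⊢
    constructor <;> linarith

/-! ### The overlap bound -/

/-- The common (unordered) lattice edges of two paths of the frame. [folklore] -/
def commonEdges (ω ω' : F.Rnd) : Finset (Sym2 (Site d)) :=
  (edges (F.verts ω)).toFinset ∩ (edges (F.verts ω')).toFinset

/-- The clock is at most two-to-one on `[0, T)`. [folklore] -/
theorem card_filter_tau_eq_le (s : Finset ℕ) (hs : s ⊆ Finset.range F.T) (b : ℕ) :
    #{t ∈ s | F.tau t = b} ≤ 2 := by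
  have hsub : ({t ∈ s | F.tau t = b}) ⊆ ({b, F.T - b} : Finset ℕ) := by
    intro t ht
    rw [Finset.mem_filter] at ht
    have := hs ht.1
    rw [Finset.mem_range] at this
    simp only [Finset.mem_insert, Finset.mem_singleton]
    unfold tau at ht
    omega
  exact (Finset.card_le_card hsub).trans (Finset.card_le_two)

/-- **The overlap bound.** Two paths of the same frame share at most `2(d+2)` times the number of
near-meeting clock times `τ ∈ [0, T]` lattice edges ("the number of edges in common is at most the
collision number"). [cite: GarbanSpencer2022, proof of Theorem 1.3, Step 2 and Lemma 2.5] -/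
theorem card_commonEdges_le (ω ω' : F.Rnd) :
    #(F.commonEdges ω ω') ≤ 2 * (d + 2) * meetCount (M F.T F.T) 0 (F.T + 1) ((ω, ω') : Pair F.T F.T) := by
  classical
  set good : Finset ℕ := {t ∈ Finset.range F.T | ((ω, ω') : Pair F.T F.T) ∈ M F.T F.T (F.tau t)} with hgood
  -- common edges lie in good blocks of `ω`
  have hsub : F.commonEdges ω ω' ⊆ good.biUnion fun t => (F.blockEdges ω t).toFinset := by
    intro e he
    rw [commonEdges, Finset.mem_inter, List.mem_toFinset, List.mem_toFinset, edges_verts, edges_verts,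
      List.mem_flatMap, List.mem_flatMap] at he
    obtain ⟨⟨t, ht, het⟩, ⟨t', -, het'⟩⟩ := he
    rw [List.mem_range] at ht
    have htt := F.eq_of_mem_blockEdges ω ω' het het'
    subst htt
    rw [Finset.mem_biUnion]
    refine ⟨t, ?_, List.mem_toFinset.2 het⟩
    rw [hgood, Finset.mem_filter, Finset.mem_range]
    exact ⟨ht, F.mem_M_of_mem_blockEdges ω ω' het het'⟩
  -- count
  have h1 : #(F.commonEdges ω ω') ≤ (d + 2) * #good := by
    refine (Finset.card_le_card hsub).trans ((Finset.card_biUnion_le).trans ?_)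
    rw [mul_comm]
    refine (Finset.sum_le_sum fun t _ => ?_).trans (by rw [Finset.sum_const, smul_eq_mul])
    exact (List.toFinset_card_le _).trans (F.length_blockEdges_le ω t)
  have h2 : #good ≤ 2 * meetCount (M F.T F.T) 0 (F.T + 1) ((ω, ω') : Pair F.T F.T) := by
    have hgr : good ⊆ Finset.range F.T := Finset.filter_subset _ _
    refine (Finset.card_le_mul_card_image good 2 fun b _ => F.card_filter_tau_eq_le good hgr b).trans ?_
    refine Nat.mul_le_mul_left 2 (Finset.card_le_card fun τ hτ => ?_)
    rw [Finset.mem_image] at hτ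
    obtain ⟨t, ht, rfl⟩ := hτ
    rw [hgood, Finset.mem_filter] at ht
    simp only [Finset.mem_filter, Finset.mem_Ico, Nat.zero_le, true_and]
    exact ⟨Nat.lt_succ_of_le (F.tau_le t), ht.2⟩
  calc #(F.commonEdges ω ω') ≤ (d + 2) * #good := h1
    _ ≤ (d + 2) * (2 * meetCount (M F.T F.T) 0 (F.T + 1) ((ω, ω') : Pair F.T F.T)) := Nat.mul_le_mul_left _ h2
    _ = _ := by ring

end Frame

end BallPath

end Literature.Probability.LatticeModels
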